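import Summits.QuantumFields.BalabanUV.Beta.FP.PeriodisedBorderWardContactInstance
import Summits.QuantumFields.BalabanUV.Beta.GAN24.FineReadoutCauchyFrame

/-!
# `BalabanUV.Beta.FP.PeriodisedCoarseWardContact` — road «FP» for binder row D1, ROUTE T row **(T-ID)**, THE COARSE COVARIANCE ROW `d1` OF THE TORUS CALL:
# **`Q₂₁·D̄ + Q₂₀·D̄₁ = 0` HOLDS EXACTLY WHEN THE COARSE INSERTION TABLE IS TRANSPORTED BY THE AVERAGING COLUMN** — for the chain-rule coarse insertion
# `Q₂₁^{(κ,u)} := Σ_{a′} T a′ • Q₂₁^{a′}` (`Q₂₁^{a′}` = the level-`(j+1)` ROOTED one-slot border table `vhSAt (toSite r′)` at the coarse bond `a′ = (p̄′, m′)`, periodised on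
# the coarse box `M′` and read on the torus call's coarse-coarse multiplier rows `(pμ′, inr mμ′)`), the record's coarse generator `D̄ = stepScale_j·#B·tgrad M′↾Res′` and the
# record's coarse jet `D̄₁^{(κ,u)}((p̄,m), t̄) = −(Lc^{d+1}·stepScale_j)⁻¹ · Q₁₀((p̄,m),(u,κ)) · [t̄ = p̄ + e_m]` (p314580 `torus_c1_vhSAt`), BOTH terms are the SAME tip-contact sum
# `Σ_{a′} (…) · [t̄ = p̄′ + e_{m′}] · Q₂₀(α, a′)`: the residual is `Σ_{a′} (T a′·s_j·#B·(Lc^{d+1}·s_{j+1})⁻¹ − (Lc^{d+1}·s_j)⁻¹·Q₁₀(a′,(u,κ)))·[t̄ = a′⁺]·Q₂₀(α,a′)`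
# (`d1_residual_apply`), hence **`d1` holds for `T a′ = θ_j · Q₁₀(a′,(u,κ))`, `θ_j = stepScale_{j+1} ∕ (stepScale_j² · #B)`** (`torus_d1_vhSAt`, `_weighted`) — the transport
# weight of the coarse bond `a′` along the fine insertion `(u,κ)` is PINNED to the averaging column (chain rule through the LINEAR average at `U = 1`), not free

HONEST DEPENDENCY (page 1, mandatory): continuum YM on T⁴ ⇐ BetaPertH ∧ nine spine estimates (0/9 proved); BetaPertH ⇐ (D1) ∧ (D4) ∧ CAP+tail;
G-an2-4 gates asym, D1 and NE2/3/4.  HONEST FRAMING (cell contract, verbatim): «discharging `BetaPertH` makes Bałaban's UV stability UNCONDITIONAL —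
a real constructive-QFT result; it is NOT the continuum limit and NOT the Clay problem.»  ABSOLUTE RULE (cell charter, verbatim): «No internally-minted
statement may enter as a cited fact. Every hypothesis is either kernel-proved in this package or a verbatim quotation of a PUBLISHED theorem with page
reference. The manuscript(s) under audit are NOT citable for their own disputed steps — they are the thing under adjudication; programme-internal
(2001/route/tribunal) claims are never citable.»  THIS MODULE is [folklore] finite-sum bookkeeping over OUR typed objects: g17's `PeriodisedBorderWardContact.
submatrix_vhSAt_mul_tgrad_of_not_root` (the tip contact) ONE LEVEL UP on the coarse box, p314580's explicit `D̄₁`, the torus call's `Q₂₀`∕`D̄` by their defining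
equations (p313662 ∕ `…Delta` VERBATIM); no `def`, no `def … : Prop`, nothing cited, 0 sorry; 0 estimates; 0∕4 row-D1 binders; NOT (T-ID) complete (WHETHER the
dictionary's transport weight IS `θ_j ·` the averaging column — i.e. whether Bałaban's nonlinear average linearises at `U = 1` to exactly OUR `Q₁₀` with this
normalisation — is the dictionary's ∕ the OWNER's; `c2 d2` need the second-order tables), NOT SDF, NOT D1, NOT BetaPertH, NOT continuum, NOT Clay.
«not in print; our bookkeeping».

WHY (OWNER d1-p3 g17, N2B-DESIGN §23 (23b) presentation T-α; g17's OFFER O-4, this seat's O-d1leaf02g18-2).  The torus call displays `d1 : Q₂₁ * Dbar + Q₂₀ * Db₁ = 0` with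
the SAME `Db₁` as in `c1 : Q₁₁ * [D₂|D₁] + Q₁₀ * W₁ = [Db₁|0]`; p314580 fixed `W₁`, hence `Db₁`.  In T-α the coarse insertion table along a fine one-shot direction is
the chain-rule sum of the coarse one-slot tables weighted by the transport of the coarse background; this file computes both terms of `d1` for ANY weights and
finds them proportional term by term, so `d1` PINS the weights.

CONTENT (generic `d`; coarse box `M′` with `Lc ∣ M′ᵢ`, coarse root `toSite r′`, `r′ ∈ box`; any coarse-coarse multiplier presentation `(pμ′, mμ′)`; every `j`).
* §1 [folklore] `sum_smul_mul`, `sum_smul_apply`.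
* §2 **`coarse_vhSAt_mul_Dbar_apply`** — THE COARSE TIP CONTACT: `(Q₂₁^{a′}·D̄)(α, t̄) = s_j·#B·[t̄ = p̄′ + e_{m′}]·(Lc^{d+1}·s_{j+1})⁻¹·Q₂₀(α, a′)` (`eq_mul_div`: `M′ = Lc·(M′∕Lc)`).
* §3 **`Q20_mul_Db1_apply`** — `(Q₂₀·D̄₁^{b})(α, t̄) = −(Lc^{d+1}·s_j)⁻¹·Σ_{a′} Q₂₀(α,a′)·Q₁₀(a′,b)·[t̄ = a′⁺]`.
* §4 **`d1_residual_apply`** (general `T`), **`torus_d1_vhSAt`** (`d1` EXACTLY for `T = θ_j·Q₁₀(·, b)`; `field_simp; ring` on the scalar), **`torus_d1_vhSAt_weighted`**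
  (any weight `h` over the insertion bonds, matching `torus_c1_vhSAt_weighted`).
NOT HERE: the identification of `θ_j·Q₁₀(·,b)` with the dictionary's transport jet (Q-FP-16-5 ∕ the coarse background's chain rule); `c2`, `d2`; the (0.4)-sym tables.
Provenance: D1 formalisation swarm LEAF PROVER 02, unit b2b-balaban-beta-d1-formalise-leaf-02 gen 18, 2026-08-22.  No existing file touched.
-/

noncomputable section

open scoped BigOperators

namespace Summit.QuantumFields.BalabanUV.Beta.FP.PeriodisedCoarseWardContact

open Finset Matrix
open Literature.Probability.LatticeModels (Torus.proj)
open Literature.MathematicalPhysics.QuantumFieldTheory.Balaban1983to89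
open Literature.MathematicalPhysics.QuantumFieldTheory.Balaban1983to89.Beta
open B5Prop11Plancherel (fine)
open B6Lemma24Torus (pbox)
open AffineAveraging (Site box toSite unitVec)
open AveragingHessianKernelsRooted (vhSAt)
open OneStepResolventKernel (Fib)
open Summit.QuantumFields.BalabanUV.Beta.BorderedHessian (bhKStepAt stepScale stepScale_ne_zero)
open Summit.QuantumFields.BalabanUV.Beta.FP.KernelPeriodisationFib (Idx perF)
open Summit.QuantumFields.BalabanUV.Beta.FP.KernelPeriodisationFibLoc (dper)
open Summit.QuantumFields.BalabanUV.Beta.FP.TorusGaugeCovariance (tdelta tgrad)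
open Summit.QuantumFields.BalabanUV.Beta.FP.TorusGaugeCovarianceCoarse (coarsePt)
open Summit.QuantumFields.BalabanUV.Beta.FP.TorusCombRows (Res ne_rootOf_iff_proj_ne)
open Summit.QuantumFields.BalabanUV.Beta.GAN24.FineReadoutCauchyFrame (toSite_mem_range)
open Summit.QuantumFields.BalabanUV.Beta.FP.PeriodisedBorderWardContact (submatrix_vhSAt_mul_tgrad_of_not_root)

variable {d : ℕ} (M' : Fin (d + 1) → ℕ) [∀ μ, NeZero (M' μ)] {Lc : ℕ} [NeZero Lc] {r r' : Fin (d + 1) → ℕ}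

/-! ## §1 Generic bookkeeping: weighted sums of tables against a column block -/

section Generic

variable {ι m n k : Type*} [Fintype ι] [Fintype n]

/-- [folklore] `(Σ_i T i • A i) * D = Σ_i T i • (A i * D)`. -/
theorem sum_smul_mul (T : ι → ℝ) (A : ι → Matrix m n ℝ) (D : Matrix n k ℝ) :
    (∑ i, T i • A i) * D = ∑ i, T i • (A i * D) := by
  rw [Matrix.sum_mul]
  exact Finset.sum_congr rfl fun i _ => Matrix.smul_mul (T i) (A i) D

/-- [folklore] entries of a weighted sum of matrices. -/
theorem sum_smul_apply (T : ι → ℝ) (B : ι → Matrix m k ℝ) (a : m) (t : k) :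
    (∑ i, T i • B i) a t = ∑ i, T i * B i a t := by
  simp only [Matrix.sum_apply, Matrix.smul_apply, smul_eq_mul]

end Generic

/-! ## §2 ONE LEVEL UP: the coarse one-slot border table against the coarse generator `D̄` of the torus call is a TIP CONTACT read by `Q₂₀` -/

section Coarse

omit [∀ μ, NeZero (M' μ)] [NeZero Lc] in
/-- [folklore] a box divisible by `Lc` has the period shape `M′ = Lc · (M′ ∕ Lc)`. -/
theorem eq_mul_div (hM' : ∀ i, Lc ∣ M' i) (i : Fin (d + 1)) : M' i = Lc * (M' i / Lc) :=
  (Nat.mul_div_cancel' (hM' i)).symm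

/-- [folklore] **THE COARSE TIP CONTACT** (g17's `submatrix_vhSAt_mul_tgrad_of_not_root` ONE LEVEL UP, in the torus call's coarse presentation): for the coarse insertion
bond `a′ = (p̄′, m′)` and the torus call's coarse generator `D̄ = stepScale_j·#B·tgrad M′↾Res′` (`hDbar` verbatim),
`(Q₂₁^{a′} · D̄)(α, t̄) = stepScale d Lc j · #B · [t̄ = p̄′ + e_{m′}] · (Lc^{d+1}·stepScale d Lc (j+1))⁻¹ · Q₂₀(α, a′)`, with
`Q₂₁^{a′} := perF M′ (dper M′ (vhSAt (toSite r′) d Lc rfl m′ p̄′))∘((pμ′, inr mμ′), fields)` and `Q₂₀` the level-`(j+1)` one-step rows (`hQ₂₀` verbatim). -/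
theorem coarse_vhSAt_mul_Dbar_apply (hr' : r' ∈ box (d + 1) Lc) (hM' : ∀ i, Lc ∣ M' i) (j : ℕ)
    {κI : Type*} (pμ' : κI → ↥(pbox M')) (mμ' : κI → Fin (d + 1))
    {Q₂₀ : Matrix κI (↥(pbox M') × Fin (d + 1)) ℝ}
    (hQ₂₀ : Q₂₀ = (perF M' (bhKStepAt d (toSite r') Lc (j + 1))).submatrix (fun a : κI => ((pμ' a, Sum.inr (mμ' a)) : Idx M' (Fib d)))
        (fun b : ↥(pbox M') × Fin (d + 1) => ((b.1, Sum.inl b.2) : Idx M' (Fib d))))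
    {Dbar : Matrix (↥(pbox M') × Fin (d + 1)) (Res (toSite r') Lc M') ℝ}
    (hDbar : Dbar = Matrix.of fun (a : ↥(pbox M') × Fin (d + 1)) (t : Res (toSite r') Lc M') =>
        stepScale d Lc j * (((box (d + 1) Lc).card : ℝ) * tgrad M' (a.1, Sum.inl a.2) t.1))
    (a' : ↥(pbox M') × Fin (d + 1)) (α : κI) (t : Res (toSite r') Lc M') :
    ((perF M' (dper M' (vhSAt (toSite r') d Lc rfl a'.2 (a'.1 : Site (d + 1))))).submatrix (fun a : κI => ((pμ' a, Sum.inr (mμ' a)) : Idx M' (Fib d)))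
          (fun b : ↥(pbox M') × Fin (d + 1) => ((b.1, Sum.inl b.2) : Idx M' (Fib d))) * Dbar) α t
      = stepScale d Lc j * ((box (d + 1) Lc).card : ℝ)
          * (tdelta M' ((a'.1 : Site (d + 1)) + unitVec a'.2) t.1 * ((((Lc : ℝ) ^ (d + 1) * stepScale d Lc (j + 1))⁻¹) * Q₂₀ α a')) := by
  have hLc : 0 < Lc := Nat.pos_of_ne_zero (NeZero.ne Lc)
  -- the tip contact one level up, against the plain `tgrad` columns read on the residual parameters (g17's lemma, `exact` up to `Subtype`∕`Prod` eta)
  have key : ∑ x : ↥(pbox M') × Fin (d + 1),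
      (perF M' (dper M' (vhSAt (toSite r') d Lc rfl a'.2 (a'.1 : Site (d + 1))))).submatrix (fun a : κI => ((pμ' a, Sum.inr (mμ' a)) : Idx M' (Fib d)))
          (fun b : ↥(pbox M') × Fin (d + 1) => ((b.1, Sum.inl b.2) : Idx M' (Fib d))) α x
        * (tgrad M').submatrix (fun b : ↥(pbox M') × Fin (d + 1) => ((b.1, Sum.inl b.2) : Idx M' (Fib d)))
            (Subtype.val : Res (toSite r') Lc M' → ↥(pbox M')) x t
      = tdelta M' ((a'.1 : Site (d + 1)) + unitVec a'.2) t.1 * ((((Lc : ℝ) ^ (d + 1) * stepScale d Lc (j + 1))⁻¹) * Q₂₀ α a') := by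
    have h := submatrix_vhSAt_mul_tgrad_of_not_root (M := M') (M' := fun i => M' i / Lc) (eq_mul_div M' hM') hr' (j + 1)
      (fun a : κI => ((pμ' a : ↥(pbox M')) : Site (d + 1))) (fun a => (pμ' a).2) mμ' (Subtype.val : Res (toSite r') Lc M' → ↥(pbox M'))
      (fun s : Res (toSite r') Lc M' => (ne_rootOf_iff_proj_ne hLc (toSite_mem_range hr') s.site).1 s.not_root) a'.2 a'.1 α t
    rw [Matrix.mul_apply] at h
    rw [hQ₂₀]
    exact h
  -- `Dbar` is the scalar `stepScale_j·#B` times those columns, entry by entry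
  have hentry : ∀ x : ↥(pbox M') × Fin (d + 1),
      (perF M' (dper M' (vhSAt (toSite r') d Lc rfl a'.2 (a'.1 : Site (d + 1))))).submatrix (fun a : κI => ((pμ' a, Sum.inr (mμ' a)) : Idx M' (Fib d)))
          (fun b : ↥(pbox M') × Fin (d + 1) => ((b.1, Sum.inl b.2) : Idx M' (Fib d))) α x * Dbar x t
        = (stepScale d Lc j * ((box (d + 1) Lc).card : ℝ))
          * ((perF M' (dper M' (vhSAt (toSite r') d Lc rfl a'.2 (a'.1 : Site (d + 1))))).submatrix (fun a : κI => ((pμ' a, Sum.inr (mμ' a)) : Idx M' (Fib d)))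
              (fun b : ↥(pbox M') × Fin (d + 1) => ((b.1, Sum.inl b.2) : Idx M' (Fib d))) α x
            * (tgrad M').submatrix (fun b : ↥(pbox M') × Fin (d + 1) => ((b.1, Sum.inl b.2) : Idx M' (Fib d)))
                (Subtype.val : Res (toSite r') Lc M' → ↥(pbox M')) x t) := fun x => by
    rw [hDbar]
    simp only [Matrix.of_apply, Matrix.submatrix_apply]
    ring
  rw [Matrix.mul_apply, Finset.sum_congr rfl fun x _ => hentry x, ← Finset.mul_sum, key]

end Coarse

/-! ## §3 The torus call's `Q₂₀ · D̄₁` with the record's coarse jet `D̄₁` (p314580) -/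

section Jet

omit [∀ μ, NeZero (M' μ)] [NeZero Lc] in
/-- [folklore] **`(Q₂₀ · D̄₁^{(κ,u)})(α, t̄) = −(Lc^{d+1}·stepScale d Lc j)⁻¹ · Σ_{a′} Q₂₀(α, a′) · Q₁₀(a′, (u,κ)) · [t̄ = p̄′ + e_{m′}]`** for the record's coarse jet
`D̄₁^{(κ,u)}((p̄,m), t̄) = −c · Q₁₀((p̄,m), (u,κ)) · tdelta M′ (p̄ + e_m) t̄` (p314580 `torus_c1_vhSAt`). -/
theorem Q20_mul_Db1_apply (j : ℕ) {κI : Type*} (Q₂₀ : Matrix κI (↥(pbox M') × Fin (d + 1)) ℝ)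
    (Q₁₀ : Matrix (↥(pbox M') × Fin (d + 1)) (↥(pbox (fine Lc M')) × Fin (d + 1)) ℝ) (b : ↥(pbox (fine Lc M')) × Fin (d + 1))
    (α : κI) (t : Res (toSite r') Lc M') :
    (Q₂₀ * Matrix.of fun (a : ↥(pbox M') × Fin (d + 1)) (t : Res (toSite r') Lc M') =>
        -((((Lc : ℝ) ^ (d + 1) * stepScale d Lc j)⁻¹) * Q₁₀ a b * tdelta M' ((a.1 : Site (d + 1)) + unitVec a.2) t.1)) α t
      = -((((Lc : ℝ) ^ (d + 1) * stepScale d Lc j)⁻¹)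
          * ∑ a : ↥(pbox M') × Fin (d + 1), Q₂₀ α a * Q₁₀ a b * tdelta M' ((a.1 : Site (d + 1)) + unitVec a.2) t.1) := by
  rw [Matrix.mul_apply, Finset.mul_sum, ← Finset.sum_neg_distrib]
  refine Finset.sum_congr rfl fun a _ => ?_
  rw [Matrix.of_apply]
  ring

end Jet

/-! ## §4 ROW `d1` OF THE TORUS CALL for the chain-rule coarse insertion table `Q₂₁^{(κ,u)} := Σ_{a′} T a′ • Q₂₁^{a′}`: the residual for general weights `T`,
and `d1` EXACTLY for the averaging-column weights `T a′ = θ_j · Q₁₀(a′, (u,κ))` -/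

section D1

/-- [folklore] **THE RESIDUAL OF ROW `d1` FOR GENERAL TRANSPORT WEIGHTS**: with `Q₂₁ := Σ_{a′} T a′ • Q₂₁^{a′}` and the record's `D̄`, `D̄₁^{(κ,u)}`, `Q₂₀`,
`(Q₂₁·D̄ + Q₂₀·D̄₁)(α, t̄) = Σ_{a′} (T a′ · stepScale_j·#B·(Lc^{d+1}·stepScale_{j+1})⁻¹ − (Lc^{d+1}·stepScale_j)⁻¹ · Q₁₀(a′,(u,κ))) · [t̄ = p̄′ + e_{m′}] · Q₂₀(α, a′)`. -/
theorem d1_residual_apply (hr' : r' ∈ box (d + 1) Lc) (hM' : ∀ i, Lc ∣ M' i) (j : ℕ)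
    {κI : Type*} (pμ' : κI → ↥(pbox M')) (mμ' : κI → Fin (d + 1))
    {Q₂₀ : Matrix κI (↥(pbox M') × Fin (d + 1)) ℝ}
    (hQ₂₀ : Q₂₀ = (perF M' (bhKStepAt d (toSite r') Lc (j + 1))).submatrix (fun a : κI => ((pμ' a, Sum.inr (mμ' a)) : Idx M' (Fib d)))
        (fun b : ↥(pbox M') × Fin (d + 1) => ((b.1, Sum.inl b.2) : Idx M' (Fib d))))
    {Dbar : Matrix (↥(pbox M') × Fin (d + 1)) (Res (toSite r') Lc M') ℝ}
    (hDbar : Dbar = Matrix.of fun (a : ↥(pbox M') × Fin (d + 1)) (t : Res (toSite r') Lc M') =>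
        stepScale d Lc j * (((box (d + 1) Lc).card : ℝ) * tgrad M' (a.1, Sum.inl a.2) t.1))
    (Q₁₀ : Matrix (↥(pbox M') × Fin (d + 1)) (↥(pbox (fine Lc M')) × Fin (d + 1)) ℝ) (b : ↥(pbox (fine Lc M')) × Fin (d + 1))
    (T : ↥(pbox M') × Fin (d + 1) → ℝ) (α : κI) (t : Res (toSite r') Lc M') :
    ((∑ a' : ↥(pbox M') × Fin (d + 1), T a' •
          (perF M' (dper M' (vhSAt (toSite r') d Lc rfl a'.2 (a'.1 : Site (d + 1))))).submatrix (fun a : κI => ((pμ' a, Sum.inr (mμ' a)) : Idx M' (Fib d)))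
            (fun b : ↥(pbox M') × Fin (d + 1) => ((b.1, Sum.inl b.2) : Idx M' (Fib d)))) * Dbar
        + Q₂₀ * Matrix.of fun (a : ↥(pbox M') × Fin (d + 1)) (t : Res (toSite r') Lc M') =>
            -((((Lc : ℝ) ^ (d + 1) * stepScale d Lc j)⁻¹) * Q₁₀ a b * tdelta M' ((a.1 : Site (d + 1)) + unitVec a.2) t.1)) α t
      = ∑ a' : ↥(pbox M') × Fin (d + 1),
          (T a' * (stepScale d Lc j * ((box (d + 1) Lc).card : ℝ) * (((Lc : ℝ) ^ (d + 1) * stepScale d Lc (j + 1))⁻¹))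
              - (((Lc : ℝ) ^ (d + 1) * stepScale d Lc j)⁻¹) * Q₁₀ a' b)
            * (tdelta M' ((a'.1 : Site (d + 1)) + unitVec a'.2) t.1 * Q₂₀ α a') := by
  rw [Matrix.add_apply, sum_smul_mul, sum_smul_apply, Q20_mul_Db1_apply M' j Q₂₀ Q₁₀ b α t, neg_mul_eq_neg_mul, Finset.mul_sum, ← Finset.sum_add_distrib]
  refine Finset.sum_congr rfl fun a' _ => ?_
  rw [coarse_vhSAt_mul_Dbar_apply M' hr' hM' j pμ' mμ' hQ₂₀ hDbar a' α t]
  ring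

/-- [folklore] **ROW `d1` OF THE TORUS CALL, EXACTLY, FOR THE AVERAGING-COLUMN TRANSPORT WEIGHTS** `T a′ = θ_j · Q₁₀(a′, (u,κ))`,
`θ_j := stepScale d Lc (j+1) ∕ (stepScale d Lc j ^ 2 · #B)` (chain rule through the LINEAR average at `U = 1`; the scalar makes
`θ_j · stepScale_j · #B · (Lc^{d+1}·stepScale_{j+1})⁻¹ = (Lc^{d+1}·stepScale_j)⁻¹`):  `Q₂₁^{(κ,u)} · D̄ + Q₂₀ · D̄₁^{(κ,u)} = 0` with
`Q₂₁^{(κ,u)} := Σ_{a′} (θ_j · Q₁₀(a′,(u,κ))) • Q₂₁^{a′}` — the binder `d1` of `NestedStepLawTorusInstance(Delta)` for the single-bond insertion `b = (u, κ)`, with the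
`D̄₁` of p314580's `torus_c1_vhSAt` (so `c1` and `d1` hold for the SAME `Db₁`). -/
theorem torus_d1_vhSAt (hr' : r' ∈ box (d + 1) Lc) (hM' : ∀ i, Lc ∣ M' i) (j : ℕ)
    {κI : Type*} (pμ' : κI → ↥(pbox M')) (mμ' : κI → Fin (d + 1))
    {Q₂₀ : Matrix κI (↥(pbox M') × Fin (d + 1)) ℝ}
    (hQ₂₀ : Q₂₀ = (perF M' (bhKStepAt d (toSite r') Lc (j + 1))).submatrix (fun a : κI => ((pμ' a, Sum.inr (mμ' a)) : Idx M' (Fib d)))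
        (fun b : ↥(pbox M') × Fin (d + 1) => ((b.1, Sum.inl b.2) : Idx M' (Fib d))))
    {Dbar : Matrix (↥(pbox M') × Fin (d + 1)) (Res (toSite r') Lc M') ℝ}
    (hDbar : Dbar = Matrix.of fun (a : ↥(pbox M') × Fin (d + 1)) (t : Res (toSite r') Lc M') =>
        stepScale d Lc j * (((box (d + 1) Lc).card : ℝ) * tgrad M' (a.1, Sum.inl a.2) t.1))
    (Q₁₀ : Matrix (↥(pbox M') × Fin (d + 1)) (↥(pbox (fine Lc M')) × Fin (d + 1)) ℝ) (b : ↥(pbox (fine Lc M')) × Fin (d + 1)) :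
    (∑ a' : ↥(pbox M') × Fin (d + 1), (stepScale d Lc (j + 1) / (stepScale d Lc j ^ 2 * ((box (d + 1) Lc).card : ℝ)) * Q₁₀ a' b) •
          (perF M' (dper M' (vhSAt (toSite r') d Lc rfl a'.2 (a'.1 : Site (d + 1))))).submatrix (fun a : κI => ((pμ' a, Sum.inr (mμ' a)) : Idx M' (Fib d)))
            (fun b : ↥(pbox M') × Fin (d + 1) => ((b.1, Sum.inl b.2) : Idx M' (Fib d)))) * Dbar
        + Q₂₀ * Matrix.of (fun (a : ↥(pbox M') × Fin (d + 1)) (t : Res (toSite r') Lc M') =>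
            -((((Lc : ℝ) ^ (d + 1) * stepScale d Lc j)⁻¹) * Q₁₀ a b * tdelta M' ((a.1 : Site (d + 1)) + unitVec a.2) t.1)) = 0 := by
  have hB : ((box (d + 1) Lc).card : ℝ) ≠ 0 := by
    have hcard : (box (d + 1) Lc).card = Lc ^ (d + 1) := by simp [AffineAveraging.box, Fintype.card_piFinset]
    rw [hcard]
    exact_mod_cast pow_ne_zero _ (NeZero.ne Lc)
  have hL : (Lc : ℝ) ^ (d + 1) ≠ 0 := pow_ne_zero _ (by exact_mod_cast NeZero.ne Lc)
  have hs : stepScale d Lc j ≠ 0 := stepScale_ne_zero (d := d) (Lc := Lc) j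
  have hs' : stepScale d Lc (j + 1) ≠ 0 := stepScale_ne_zero (d := d) (Lc := Lc) (j + 1)
  ext α t
  rw [d1_residual_apply M' hr' hM' j pμ' mμ' hQ₂₀ hDbar Q₁₀ b _ α t, Matrix.zero_apply]
  refine Finset.sum_eq_zero fun a' _ => ?_
  have hθ : stepScale d Lc (j + 1) / (stepScale d Lc j ^ 2 * ((box (d + 1) Lc).card : ℝ)) * Q₁₀ a' b
        * (stepScale d Lc j * ((box (d + 1) Lc).card : ℝ) * (((Lc : ℝ) ^ (d + 1) * stepScale d Lc (j + 1))⁻¹))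
      - (((Lc : ℝ) ^ (d + 1) * stepScale d Lc j)⁻¹) * Q₁₀ a' b = 0 := by
    field_simp
    ring
  rw [hθ, zero_mul]

/-- [folklore] **ROW `d1`, WEIGHTED OVER THE INSERTION BONDS** (any weight `h` on the fine torus bonds — the one-shot direction's components; the same `h`-weighted
`D̄₁` as p314580's `torus_c1_vhSAt_weighted`, so `c1` and `d1` hold for ONE `Db₁`):
`(Σ_b h b • Q₂₁^{b}) · D̄ + Q₂₀ · (Σ_b h b • D̄₁^{b}) = 0`. -/
theorem torus_d1_vhSAt_weighted (hr' : r' ∈ box (d + 1) Lc) (hM' : ∀ i, Lc ∣ M' i) (j : ℕ)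
    {κI : Type*} (pμ' : κI → ↥(pbox M')) (mμ' : κI → Fin (d + 1))
    {Q₂₀ : Matrix κI (↥(pbox M') × Fin (d + 1)) ℝ}
    (hQ₂₀ : Q₂₀ = (perF M' (bhKStepAt d (toSite r') Lc (j + 1))).submatrix (fun a : κI => ((pμ' a, Sum.inr (mμ' a)) : Idx M' (Fib d)))
        (fun b : ↥(pbox M') × Fin (d + 1) => ((b.1, Sum.inl b.2) : Idx M' (Fib d))))
    {Dbar : Matrix (↥(pbox M') × Fin (d + 1)) (Res (toSite r') Lc M') ℝ}
    (hDbar : Dbar = Matrix.of fun (a : ↥(pbox M') × Fin (d + 1)) (t : Res (toSite r') Lc M') =>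
        stepScale d Lc j * (((box (d + 1) Lc).card : ℝ) * tgrad M' (a.1, Sum.inl a.2) t.1))
    (Q₁₀ : Matrix (↥(pbox M') × Fin (d + 1)) (↥(pbox (fine Lc M')) × Fin (d + 1)) ℝ) (h : ↥(pbox (fine Lc M')) × Fin (d + 1) → ℝ) :
    (∑ b : ↥(pbox (fine Lc M')) × Fin (d + 1), h b •
        ∑ a' : ↥(pbox M') × Fin (d + 1), (stepScale d Lc (j + 1) / (stepScale d Lc j ^ 2 * ((box (d + 1) Lc).card : ℝ)) * Q₁₀ a' b) •
          (perF M' (dper M' (vhSAt (toSite r') d Lc rfl a'.2 (a'.1 : Site (d + 1))))).submatrix (fun a : κI => ((pμ' a, Sum.inr (mμ' a)) : Idx M' (Fib d)))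
            (fun b : ↥(pbox M') × Fin (d + 1) => ((b.1, Sum.inl b.2) : Idx M' (Fib d)))) * Dbar
        + Q₂₀ * ∑ b : ↥(pbox (fine Lc M')) × Fin (d + 1), h b •
            Matrix.of (fun (a : ↥(pbox M') × Fin (d + 1)) (t : Res (toSite r') Lc M') =>
              -((((Lc : ℝ) ^ (d + 1) * stepScale d Lc j)⁻¹) * Q₁₀ a b * tdelta M' ((a.1 : Site (d + 1)) + unitVec a.2) t.1)) = 0 := by
  rw [sum_smul_mul, Matrix.mul_sum, ← Finset.sum_add_distrib]
  refine Finset.sum_eq_zero fun b _ => ?_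
  rw [Matrix.mul_smul, ← smul_add, torus_d1_vhSAt M' hr' hM' j pμ' mμ' hQ₂₀ hDbar Q₁₀ b, smul_zero]

end D1

end Summit.QuantumFields.BalabanUV.Beta.FP.PeriodisedCoarseWardContact

end
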